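/-
Copyright (c) 2026 the pub-hodgecm-mathlib formalisation cell (harness21).  Prover seat hodgecm-mathlib-K2E1-p10 (g0), Track B ∕ K2-LIT, h413 = `stmt-HodgeConjecture-24833`,
line `K2_E1_TraceFormulaBeta`, campaign «EIS-WHITTAKER-3», DEAL D-W4 «W2₃-fin-split» of the dealer K2E1-plan (g5) 2026-09-04T08:09:42Z (DEALS MEMO fe56b7cd5d935977) + the
dealer's «+1» 08:19:48Z (holomorphy on the window), FILE C of three: THE UNIT-FREQUENCY WHITTAKER INTEGRAL OF THE SPHERICAL SECTION OF `GL₃(F)` AT A SPLIT PLACE,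
`μ(𝒪)³·(1 − q^{−s})²·(1 − q^{−(2s−1)})`, its Haar and `t`-symbol forms, and — for EVERY frequency — the trivial bound and holomorphy on `{1 < Re s}`.
-/
import Summits.HodgeConjecture.HodgeConjecture.Theorems.K2E1FiniteWhittakerSplitU3Fibre   -- ★ FILE B (this seat): the `x`-fibres (values on `𝒪` and on `‖x‖ = q`, radial, integrable); brings FILE A
import Literature.Analysis.Complex.HolomorphicParametricIntegral                        -- ★ `differentiableOn_integral_of_dominated` (holomorphy of dominated parameter integrals)
import HarnessLib

/-!
# K2·E1 — `K2E1FiniteWhittakerSplitU3` (D-W4 FILE C): `∫_{N(F)} Φ_s(w₀n) ψ_N(n)⁻ dn = μ(𝒪)³·(1 − q^{−s})²·(1 − q^{−(2s−1)})` for `GL₃(F)` at unit frequency; the window `Re s > 1`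

Track B ∕ K2-LIT, crux h413 = `stmt-HodgeConjecture-24833`, route of record `HCCMUnconditional`; cell `hodgecm-mathlib`, squad K2, ENGINE E1, campaign «EIS-WHITTAKER-3», D-W4 =
CONVENTIONS W0₃ 2fdd2f7063acaab9 §4 (ii′) «WHITTAKER finite split, `v ∉ S_ξ`»; CENSUS ba907189b20ed180 §2.  THEOREMS ONLY (no `def`, no `instance`, no notation, no named-fact
hypothesis, no `sorry`).  Notation∕currency: FILE A `K2E1FiniteWhittakerSplitU3Inner` header (★ `K2E1GindikinKarpelevichSplitGL3` big-cell coordinates, complex exponent `s` per height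
factor = the RAW section `H^s`, TWO characters `ψ₁, ψ₂ = ψ_w, ψ_w̄` with conductor letters `m₁, m₂`, frequencies `(t * ξᵢ)` à la ★ p858310).

THE MATHEMATICS [CasselmanShalika1980, Thm. 5.4 at `g = 1`; Shintani1976; Casselman1980, Thm. 3.1].  For the spherical vector of `Ind(λ)`, `λ = (s−1)ρ`, the Jacquet integral over
`N(F)` against a character of conductor `N(𝒪)` equals `∏_{α>0} ζ(⟨λ,α^∨⟩+1)⁻¹ = ζ(s)⁻²ζ(2s−1)⁻¹` (times `μ(𝒪)³`), versus `∏ ζ(⟨λ,α^∨⟩)∕ζ(⟨λ,α^∨⟩+1)` untwisted (★ Gindikin–Karpelevich).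
PROOF (by hand, no Casselman–Shalika machinery): in the ★ order `x, z, y` with the `y`-character innermost every stage is a RADIAL function against a character, evaluated by
FILE A §1 (the shell formula): FILE A §4 (inner integral), FILE B §5 (fibres `μ(𝒪)²(1−c)` on `𝒪`, `μ(𝒪)²c(1 + (q−1)c − 2qc² + qc³)` on `‖x‖ = q`, `c = q^{−s}`), and here the last
shell formula in `x`: `μ(𝒪)³[(1−c) − c(1 + (q−1)c − 2qc² + qc³)] = μ(𝒪)³(1 − c)²(1 − qc²)`, `qc² = q^{−(2s−1)}`.  Checked numerically (`q = 2`, `s = 2`: `0.4922 = (3∕4)²·(7∕8)`).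
* §7 **`integral_bigCell_whittaker_gl3_eq`** (frequencies of level zero w.r.t. arbitrary conductor exponents), **`…_of_conductor_zero`** (THE DEALT HEAD: conductor `𝒪`, `‖ξᵢ‖ = 1`),
  `…_of_measureReal_eq_one` (`μ(𝒪) = 1`: `(1 − q^{−s})²(1 − q^{−(2s−1)})` on the nose = `[ζ_{L,w}(s)ζ_{L,w̄}(s)L_v(2s−1,ω_{L∕L⁺})]⁻¹`, `ω_v = 1`, the `v`-factor of the Whittaker
  normaliser of ★ p858416 `K2E1IntertwiningScalarContinuationU3`).
* §8 THE WINDOW `Re s > 1` FOR EVERY FREQUENCY AND EVERY PAIR OF CONDUCTORS: the integrand `g_s` is integrable on `F × (F × F)` (its modulus IS the ★ Haar-form GK integrand at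
  `σ = Re s`); HAAR FORM = ITERATED FORM (Fubini); the unit value in Haar form and in the `t`-SYMBOL ORDER `∫_x∫_y Ψ(x,y)ψ₂ψ₁` with `Ψ(x,y) = ∫_z …` innermost (CONVENTIONS §3);
  **`norm_integral_bigCell_whittaker_gl3_le`**: `‖W(ξ;s)‖ ≤` ★ `integral_prod_bigCell_spherical_gl3_eq` at `σ` (UNIFORM in `ξ`, `|ψ| = 1`);
  **`differentiableOn_integral_bigCell_whittaker_gl3`**: `s ↦ W(ξ;s)` is HOLOMORPHIC on `{1 < Re s}` (dominated holomorphy of the Haar form, ★ Literature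
  `differentiableOn_integral_of_dominated`, majorant = the GK integrand at `σ₀ = Re s₀ − R` on `B(s₀,R)`, `R = (Re s₀−1)∕2`).
HONEST SCOPE (dealer 08:19:48Z «=»): for a general frequency the split factor is NOT claimed entire here — with `z` innermost the two-variable shell sum has coefficients that are
geometric series in `q^{−s}`; holomorphy on the window is what W3₃∕W4₃ consume; the entire continuation (character-innermost order for general `(ξ, m)`) is a separate file.
SAT-WITNESS: nothing is quantified over a structure; at `q = 2`, `μ(𝒪) = 1`, `s = 2` the unit value is `63∕128 > 0`.
HONEST LABEL: HC_CM is proved only modulo the 7 printed citations (2 remaining named inputs: hLiu418 = `stmt-HodgeConjecture-24832`, h413 = `stmt-HodgeConjecture-24833`)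
until rung 0 closes; this file asserts no named fact and closes no socket (lane `--supports stmt-HodgeConjecture-24833`, count-neutral).
References: [CasselmanShalika1980] Thm. 5.4 · [Shintani1976] Theorem · [Casselman1980] Thm. 3.1 · [Langlands1971] §3 · [MoeglinWaldspurger1995] II.1.7 · [Tate1950] §2.5.
-/

set_option autoImplicit false
-- the mandated namespace repeats the single-problem summit's segment (`HodgeConjecture.HodgeConjecture`)
set_option linter.dupNamespace false

noncomputable section

open MeasureTheory Filter Topology Set TopologicalSpace
open scoped NNReal ENNReal
open Literature.NumberTheory.GaloisRepresentations Literature.NumberTheory.GaloisRepresentations.IsNonarchimedeanLocalField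
open Literature.NumberTheory.Automorphic Literature.NumberTheory.Automorphic.LocalFieldHaar
open Summit.HodgeConjecture.HodgeConjecture.Cruxes.HLiu418.K2LiuGKRankOneIntegral
open Summit.HodgeConjecture.HodgeConjecture.Cruxes.H413.K2E1IntertwiningLocalFactorU2 (integrable_max_one_normAbs_rpow_neg integral_max_one_normAbs_rpow_neg)
open Summit.HodgeConjecture.HodgeConjecture.Cruxes.H413.K2E1GindikinKarpelevichSplitGL3
open Summit.HodgeConjecture.HodgeConjecture.Cruxes.H413.K2E1GindikinKarpelevichSplitGL3Haar
open Summit.HodgeConjecture.HodgeConjecture.Cruxes.H413.K2E1FiniteWhittakerSplitU3Inner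
open Summit.HodgeConjecture.HodgeConjecture.Cruxes.H413.K2E1FiniteWhittakerSplitU3Fibre

namespace Summit.HodgeConjecture.HodgeConjecture.Cruxes.H413.K2E1FiniteWhittakerSplitU3

variable {F : Type*} [Field F] [ValuativeRel F] [TopologicalSpace F] [IsNonarchimedeanLocalField F]
variable [MeasurableSpace F] [BorelSpace F] (μ : Measure F) [μ.IsAddHaarMeasure]

/-! ## §7  THE UNIT-FREQUENCY WHITTAKER INTEGRAL OF THE SPHERICAL SECTION OF `GL₃(F)` -/

omit [MeasurableSpace F] [BorelSpace F] in
/-- `q^{−(2s−1)} = q·(q^{−s})²` (complex powers of the positive integer `q`). [folklore] -/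
theorem residueFieldCard_cpow_neg_two_mul_sub_one (s : ℂ) :
    (residueFieldCard F : ℂ) ^ (-(2 * s - 1)) = (residueFieldCard F : ℂ) * ((residueFieldCard F : ℂ) ^ (-s)) ^ 2 := by
  have hq : (residueFieldCard F : ℂ) ≠ 0 := Nat.cast_ne_zero.2 (residueFieldCard_ne_zero F)
  rw [show -(2 * s - 1) = 1 + (-s + -s) by ring, Complex.cpow_add _ _ hq, Complex.cpow_add _ _ hq, Complex.cpow_one, sq]

/-- **THE ψ-TWISTED GINDIKIN–KARPELEVICH (= CASSELMAN–SHALIKA AT THE IDENTITY) INTEGRAL FOR `GL₃(F)` IN BIG-CELL COORDINATES, ITERATED FORM.**  Let `ψ₁, ψ₂` be continuous additive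
characters of `F` of conductor exponents `m₁, m₂`, `ξᵢ ∈ 𝔭^{mᵢ} ∖ 𝔭^{mᵢ+1}` (unit frequencies relative to the conductors — at an unramified split place `v = ww̄` of the CM pair:
`(ψ₁, ψ₂) = (ψ_w, ψ_w̄)` of conductor `𝒪`, `‖ξ_w‖ = ‖ξ_w̄‖ = 1`), `μ` any additive Haar measure and `Re s > 1`.  Then, in the order `x, z, y` of ★ `integral_bigCell_spherical_gl3_eq`,
`∫_x ( ∫_z ∫_y max(1,‖x‖,‖z‖)^{−s} · max(1,‖y‖,‖z−xy‖)^{−s} · ψ₂(yξ₂) dμ dμ ) ψ₁(xξ₁) dμ = μ(𝒪)³ · (1 − q^{−s})² · (1 − q^{−(2s−1)})`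
`= μ(𝒪)³·[ζ_F(s)·ζ_F(s)·ζ_F(2s−1)]⁻¹` — one factor `ζ(⟨λ,α^∨⟩+1)⁻¹` per positive root (`λ = (s−1)ρ`), versus `ζ(⟨λ,α^∨⟩)∕ζ(⟨λ,α^∨⟩+1)` untwisted.  PROOF: the shell formula §1 in `x`
(fibre `μ(𝒪)²(1 − q^{−s})` on `𝒪` §5, `μ(𝒪)²q^{−s}(1 + (q−1)q^{−s} − 2q^{1−2s} + q^{1−3s})` on `‖x‖ = q` §5, radial and integrable §6):
`μ(𝒪)³[(1−c) − c(1 + (q−1)c − 2qc² + qc³)] = μ(𝒪)³(1−c)²(1−qc²)`, `c = q^{−s}`.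
[cite: CasselmanShalika1980, Thm. 5.4] [cite: Casselman1980, Thm. 3.1] [cite: Shintani1976, Theorem] -/
theorem integral_bigCell_whittaker_gl3_eq {ψ₁ ψ₂ : AddChar F Circle} (hψ₁ : Continuous ψ₁) (hψ₂ : Continuous ψ₂) {m₁ m₂ : ℤ}
    (hm₁ : ψ₁.HasConductorExp m₁) (hm₂ : ψ₂.HasConductorExp m₂) {ξ₁ ξ₂ : F}
    (hξ₁ : ξ₁ ∈ primePowBall F m₁) (hξ₁' : ξ₁ ∉ primePowBall F (m₁ + 1)) (hξ₂ : ξ₂ ∈ primePowBall F m₂) (hξ₂' : ξ₂ ∉ primePowBall F (m₂ + 1))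
    {s : ℂ} (hs : 1 < s.re) :
    ∫ x, (∫ z, ((max 1 (max ((normAbs F x : ℝ≥0) : ℝ) ((normAbs F z : ℝ≥0) : ℝ)) : ℝ) : ℂ) ^ (-s) *
        (∫ y, ((max 1 (max ((normAbs F y : ℝ≥0) : ℝ) ((normAbs F (z - x * y) : ℝ≥0) : ℝ)) : ℝ) : ℂ) ^ (-s) * ((ψ₂ (y * ξ₂) : Circle) : ℂ) ∂μ) ∂μ) *
        ((ψ₁ (x * ξ₁) : Circle) : ℂ) ∂μ =
      (μ.real (primePowBall F 0) : ℂ) ^ 3 * ((1 - (residueFieldCard F : ℂ) ^ (-s)) ^ 2 * (1 - (residueFieldCard F : ℂ) ^ (-(2 * s - 1)))) := by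
  rw [integral_radial_mul_addChar_eq μ (integrable_fibre_twisted μ hψ₂ ξ₂ hs) (integral_fibre_twisted_radial μ ψ₂ ξ₂ s) hψ₁ hm₁ (n := 0)
    (by rwa [Nat.cast_zero, add_zero]) (by rwa [Nat.cast_zero, add_zero])]
  -- the fibre on `𝒪` and on the sphere `‖x‖ = q`
  have h0 : ∫ x in primePowBall F (-((0 : ℕ) : ℤ)), ∫ z, ((max 1 (max ((normAbs F x : ℝ≥0) : ℝ) ((normAbs F z : ℝ≥0) : ℝ)) : ℝ) : ℂ) ^ (-s) *
        (∫ y, ((max 1 (max ((normAbs F y : ℝ≥0) : ℝ) ((normAbs F (z - x * y) : ℝ≥0) : ℝ)) : ℝ) : ℂ) ^ (-s) * ((ψ₂ (y * ξ₂) : Circle) : ℂ) ∂μ) ∂μ ∂μ =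
      (μ.real (primePowBall F 0) : ℂ) * ((μ.real (primePowBall F 0) : ℂ) ^ 2 * (1 - (residueFieldCard F : ℂ) ^ (-s))) := by
    rw [show (-((0 : ℕ) : ℤ)) = 0 by simp, setIntegral_congr_fun (measurableSet_primePowBall 0) (fun x hx =>
      integral_fibre_twisted_of_le_one μ (by simpa [mem_primePowBall_iff] using hx) hψ₂ hm₂ hξ₂ hξ₂' hs), setIntegral_const, Complex.real_smul]
  have h1 : ∫ x in primePowBall F (-(((0 : ℕ) : ℤ) + 1)) \ primePowBall F (-(((0 : ℕ) : ℤ) + 1) + 1), ∫ z, ((max 1 (max ((normAbs F x : ℝ≥0) : ℝ) ((normAbs F z : ℝ≥0) : ℝ)) : ℝ) : ℂ) ^ (-s) *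
        (∫ y, ((max 1 (max ((normAbs F y : ℝ≥0) : ℝ) ((normAbs F (z - x * y) : ℝ≥0) : ℝ)) : ℝ) : ℂ) ^ (-s) * ((ψ₂ (y * ξ₂) : Circle) : ℂ) ∂μ) ∂μ ∂μ =
      (((residueFieldCard F : ℝ) - 1) * μ.real (primePowBall F 0) : ℝ) * ((μ.real (primePowBall F 0) : ℂ) ^ 2 * ((residueFieldCard F : ℂ) ^ (-s) *
        (1 + ((residueFieldCard F : ℂ) - 1) * (residueFieldCard F : ℂ) ^ (-s) - 2 * (residueFieldCard F : ℂ) * ((residueFieldCard F : ℂ) ^ (-s)) ^ 2 +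
          (residueFieldCard F : ℂ) * ((residueFieldCard F : ℂ) ^ (-s)) ^ 3))) := by
    rw [setIntegral_congr_fun (measurableSet_shell _) (fun x hx => integral_fibre_twisted_of_mem_outerShell_zero μ hx hψ₂ hm₂ hξ₂ hξ₂' hs),
      setIntegral_const, Complex.real_smul, measureReal_outerShell, zero_add, pow_one]
    have hq : (residueFieldCard F : ℂ) ≠ 0 := Nat.cast_ne_zero.2 (residueFieldCard_ne_zero F)
    congr 1
    push_cast
    rw [mul_sub, mul_one, mul_inv_cancel₀ hq]
  rw [h0, h1, residueFieldCard_cpow_neg_two_mul_sub_one]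
  have hq1 : (residueFieldCard F : ℂ) - 1 ≠ 0 := by
    rw [sub_ne_zero]; exact_mod_cast (one_lt_residueFieldCard F).ne'
  push_cast
  field_simp
  ring

/-- **THE UNRAMIFIED SPLIT PLACE** (the dealer's head; `ψ₁, ψ₂` of conductor `𝒪`, unit frequencies `‖ξ₁‖ = ‖ξ₂‖ = 1`, `Re s > 1`):
`∫_x (∫_z ∫_y max(1,‖x‖,‖z‖)^{−s} max(1,‖y‖,‖z−xy‖)^{−s} ψ₂(yξ₂)) ψ₁(xξ₁) dμ³ = μ(𝒪)³·(1 − q^{−s})²·(1 − q^{−(2s−1)})` — with `μ(𝒪_v) = 1` and `s = z` this is the `v`-factor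
`[ζ_{L,w}(z) ζ_{L,w̄}(z) L_v(2z−1, ω_{L∕L⁺})]⁻¹` (`ω_v = 1` at a split place) of the Whittaker normaliser of ★ `K2E1IntertwiningScalarContinuationU3`.
[cite: CasselmanShalika1980, Thm. 5.4] [cite: Casselman1980, Thm. 3.1] -/
theorem integral_bigCell_whittaker_gl3_eq_of_conductor_zero {ψ₁ ψ₂ : AddChar F Circle} (hψ₁ : Continuous ψ₁) (hψ₂ : Continuous ψ₂)
    (h₁ : ψ₁.HasConductorExp 0) (h₂ : ψ₂.HasConductorExp 0) {ξ₁ ξ₂ : F} (hξ₁ : normAbs F ξ₁ = 1) (hξ₂ : normAbs F ξ₂ = 1) {s : ℂ} (hs : 1 < s.re) :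
    ∫ x, (∫ z, ((max 1 (max ((normAbs F x : ℝ≥0) : ℝ) ((normAbs F z : ℝ≥0) : ℝ)) : ℝ) : ℂ) ^ (-s) *
        (∫ y, ((max 1 (max ((normAbs F y : ℝ≥0) : ℝ) ((normAbs F (z - x * y) : ℝ≥0) : ℝ)) : ℝ) : ℂ) ^ (-s) * ((ψ₂ (y * ξ₂) : Circle) : ℂ) ∂μ) ∂μ) *
        ((ψ₁ (x * ξ₁) : Circle) : ℂ) ∂μ =
      (μ.real (primePowBall F 0) : ℂ) ^ 3 * ((1 - (residueFieldCard F : ℂ) ^ (-s)) ^ 2 * (1 - (residueFieldCard F : ℂ) ^ (-(2 * s - 1)))) := by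
  have hmem : ∀ {ξ : F}, normAbs F ξ = 1 → ξ ∈ primePowBall F 0 := fun h => by rw [mem_primePowBall_iff, h, zpow_zero]
  have hnot : ∀ {ξ : F}, normAbs F ξ = 1 → ξ ∉ primePowBall F (0 + 1) := fun h => by
    rw [mem_primePowBall_iff, h, zero_add, zpow_one, not_le]; exact inv_residueFieldCard_lt_one
  exact integral_bigCell_whittaker_gl3_eq μ hψ₁ hψ₂ h₁ h₂ (hmem hξ₁) (hnot hξ₁) (hmem hξ₂) (hnot hξ₂) hs

/-- **Self-dual normalisation** `μ(𝒪) = 1`: the unramified split Whittaker factor ON THE NOSE, `(1 − q^{−s})²·(1 − q^{−(2s−1)})`. [cite: CasselmanShalika1980, Thm. 5.4] -/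
theorem integral_bigCell_whittaker_gl3_eq_of_conductor_zero_of_measureReal_eq_one {ψ₁ ψ₂ : AddChar F Circle} (hψ₁ : Continuous ψ₁) (hψ₂ : Continuous ψ₂)
    (h₁ : ψ₁.HasConductorExp 0) (h₂ : ψ₂.HasConductorExp 0) {ξ₁ ξ₂ : F} (hξ₁ : normAbs F ξ₁ = 1) (hξ₂ : normAbs F ξ₂ = 1) (hμ : μ.real (primePowBall F 0) = 1)
    {s : ℂ} (hs : 1 < s.re) :
    ∫ x, (∫ z, ((max 1 (max ((normAbs F x : ℝ≥0) : ℝ) ((normAbs F z : ℝ≥0) : ℝ)) : ℝ) : ℂ) ^ (-s) *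
        (∫ y, ((max 1 (max ((normAbs F y : ℝ≥0) : ℝ) ((normAbs F (z - x * y) : ℝ≥0) : ℝ)) : ℝ) : ℂ) ^ (-s) * ((ψ₂ (y * ξ₂) : Circle) : ℂ) ∂μ) ∂μ) *
        ((ψ₁ (x * ξ₁) : Circle) : ℂ) ∂μ =
      (1 - (residueFieldCard F : ℂ) ^ (-s)) ^ 2 * (1 - (residueFieldCard F : ℂ) ^ (-(2 * s - 1))) := by
  rw [integral_bigCell_whittaker_gl3_eq_of_conductor_zero μ hψ₁ hψ₂ h₁ h₂ hξ₁ hξ₂ hs, hμ, Complex.ofReal_one, one_pow, one_mul]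


/-! ## §8  The window `Re s > 1` for EVERY frequency: Haar form on `F × (F × F)`, the `t`-symbol order, the trivial bound, holomorphy -/

omit [MeasurableSpace F] [BorelSpace F] in
/-- The twisted big-cell integrand `g_s(x,(z,y)) = max(1,‖x‖,‖z‖)^{−s}·max(1,‖y‖,‖z−xy‖)^{−s}·ψ₂(yξ₂)·ψ₁(xξ₁)` is continuous on `F × (F × F)`. [folklore] -/
theorem continuous_twistedIntegrand {ψ₁ ψ₂ : AddChar F Circle} (hψ₁ : Continuous ψ₁) (hψ₂ : Continuous ψ₂) (ξ₁ ξ₂ : F) (s : ℂ) :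
    Continuous fun p : F × (F × F) => ((max 1 (max ((normAbs F p.1 : ℝ≥0) : ℝ) ((normAbs F p.2.1 : ℝ≥0) : ℝ)) : ℝ) : ℂ) ^ (-s) *
      (((max 1 (max ((normAbs F p.2.2 : ℝ≥0) : ℝ) ((normAbs F (p.2.1 - p.1 * p.2.2) : ℝ≥0) : ℝ)) : ℝ) : ℂ) ^ (-s) * ((ψ₂ (p.2.2 * ξ₂) : Circle) : ℂ)) *
        ((ψ₁ (p.1 * ξ₁) : Circle) : ℂ) := by
  refine ((continuous_ofReal_cpow_neg (continuous_const.max ((continuous_coe_normAbs.comp continuous_fst).max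
    (continuous_coe_normAbs.comp (continuous_fst.comp continuous_snd)))) (fun _ => le_max_left _ _) s).mul
    ((continuous_innerIntegrand ψ₂ hψ₂ ξ₂ s).comp ((continuous_fst.prodMk (continuous_fst.comp continuous_snd)).prodMk (continuous_snd.comp continuous_snd)))).mul
    (continuous_subtype_val.comp (hψ₁.comp (continuous_fst.mul continuous_const)))

omit [MeasurableSpace F] [BorelSpace F] in
/-- `‖g_s(x,(z,y))‖ = max(1,‖x‖,‖z‖)^{−Re s}·max(1,‖y‖,‖z−xy‖)^{−Re s}` — the ★ Haar-form Gindikin–Karpelevich integrand at `σ = Re s`. [folklore] -/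
theorem norm_twistedIntegrand (ψ₁ ψ₂ : AddChar F Circle) (ξ₁ ξ₂ : F) (s : ℂ) (p : F × (F × F)) :
    ‖((max 1 (max ((normAbs F p.1 : ℝ≥0) : ℝ) ((normAbs F p.2.1 : ℝ≥0) : ℝ)) : ℝ) : ℂ) ^ (-s) *
      (((max 1 (max ((normAbs F p.2.2 : ℝ≥0) : ℝ) ((normAbs F (p.2.1 - p.1 * p.2.2) : ℝ≥0) : ℝ)) : ℝ) : ℂ) ^ (-s) * ((ψ₂ (p.2.2 * ξ₂) : Circle) : ℂ)) *
        ((ψ₁ (p.1 * ξ₁) : Circle) : ℂ)‖ =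
      (max 1 (max ((normAbs F p.1 : ℝ≥0) : ℝ) ((normAbs F p.2.1 : ℝ≥0) : ℝ))) ^ (-s.re) *
        (max 1 (max ((normAbs F p.2.2 : ℝ≥0) : ℝ) ((normAbs F (p.2.1 - p.1 * p.2.2) : ℝ≥0) : ℝ))) ^ (-s.re) := by
  rw [norm_mul, Circle.norm_coe, mul_one, norm_mul, norm_weight_mul_addChar _ (le_max_left _ _), norm_ofReal_cpow_neg (le_max_left _ _)]

/-- **`g_s` IS INTEGRABLE ON `F × (F × F)`** against `μ ⊗ (μ ⊗ μ)` for `Re s > 1`, for EVERY pair of continuous characters and frequencies (its norm IS the ★ untwisted integrand at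
`σ = Re s`, ★ `integrable_bigCellIntegrand`). [cite: Casselman1980, Thm. 3.1] [cite: Langlands1971, §3] -/
theorem integrable_twistedIntegrand {ψ₁ ψ₂ : AddChar F Circle} (hψ₁ : Continuous ψ₁) (hψ₂ : Continuous ψ₂) (ξ₁ ξ₂ : F) {s : ℂ} (hs : 1 < s.re) :
    Integrable (fun p : F × (F × F) => ((max 1 (max ((normAbs F p.1 : ℝ≥0) : ℝ) ((normAbs F p.2.1 : ℝ≥0) : ℝ)) : ℝ) : ℂ) ^ (-s) *
      (((max 1 (max ((normAbs F p.2.2 : ℝ≥0) : ℝ) ((normAbs F (p.2.1 - p.1 * p.2.2) : ℝ≥0) : ℝ)) : ℝ) : ℂ) ^ (-s) * ((ψ₂ (p.2.2 * ξ₂) : Circle) : ℂ)) *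
        ((ψ₁ (p.1 * ξ₁) : Circle) : ℂ)) (μ.prod (μ.prod μ)) := by
  haveI : T2Space F := (isLocalField F).toT2Space
  haveI : SecondCountableTopology F := secondCountableTopology_localField F
  exact (integrable_bigCellIntegrand μ hs).mono' (continuous_twistedIntegrand hψ₁ hψ₂ ξ₁ ξ₂ s).aestronglyMeasurable
    (Eventually.of_forall fun p => (norm_twistedIntegrand ψ₁ ψ₂ ξ₁ ξ₂ s p).le)

/-- The `(z,y)`-block of `g_s` (without the `x`-character) is integrable on `F × F` for every `x` (`Re s > 1`; ★ `integrable_zySection`). [cite: Casselman1980, Thm. 3.1] -/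
theorem integrable_twisted_zySection {ψ₂ : AddChar F Circle} (hψ₂ : Continuous ψ₂) (ξ₂ : F) {s : ℂ} (hs : 1 < s.re) (x : F) :
    Integrable (fun q : F × F => ((max 1 (max ((normAbs F x : ℝ≥0) : ℝ) ((normAbs F q.1 : ℝ≥0) : ℝ)) : ℝ) : ℂ) ^ (-s) *
      (((max 1 (max ((normAbs F q.2 : ℝ≥0) : ℝ) ((normAbs F (q.1 - x * q.2) : ℝ≥0) : ℝ)) : ℝ) : ℂ) ^ (-s) * ((ψ₂ (q.2 * ξ₂) : Circle) : ℂ))) (μ.prod μ) := by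
  haveI : T2Space F := (isLocalField F).toT2Space
  haveI : SecondCountableTopology F := secondCountableTopology_localField F
  refine (integrable_zySection μ hs x).mono' ?_ (Eventually.of_forall fun q => ?_)
  · exact (((continuous_ofReal_cpow_neg (continuous_const.max (continuous_const.max (continuous_coe_normAbs.comp continuous_fst))) (fun _ => le_max_left _ _) s).mul
      ((continuous_innerIntegrand ψ₂ hψ₂ ξ₂ s).comp ((continuous_const.prodMk continuous_fst).prodMk continuous_snd))).aestronglyMeasurable)
  · rw [norm_mul, norm_weight_mul_addChar _ (le_max_left _ _), norm_ofReal_cpow_neg (le_max_left _ _)]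

/-- **HAAR FORM = ITERATED FORM** (`Re s > 1`, every continuous `ψ₁, ψ₂`, every `ξ₁, ξ₂`): `∫_{F×(F×F)} g_s d(μ⊗μ⊗μ) = ∫_x (∫_z max(1,‖x‖,‖z‖)^{−s} ∫_y max(1,‖y‖,‖z−xy‖)^{−s}ψ₂(yξ₂)) ψ₁(xξ₁)`
(Fubini ★ `integral_prod` twice on the integrable `g_s`). [cite: Casselman1980, Thm. 3.1] -/
theorem integral_prod_twisted_eq_iterated {ψ₁ ψ₂ : AddChar F Circle} (hψ₁ : Continuous ψ₁) (hψ₂ : Continuous ψ₂) (ξ₁ ξ₂ : F) {s : ℂ} (hs : 1 < s.re) :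
    ∫ p : F × (F × F), ((max 1 (max ((normAbs F p.1 : ℝ≥0) : ℝ) ((normAbs F p.2.1 : ℝ≥0) : ℝ)) : ℝ) : ℂ) ^ (-s) *
      (((max 1 (max ((normAbs F p.2.2 : ℝ≥0) : ℝ) ((normAbs F (p.2.1 - p.1 * p.2.2) : ℝ≥0) : ℝ)) : ℝ) : ℂ) ^ (-s) * ((ψ₂ (p.2.2 * ξ₂) : Circle) : ℂ)) *
        ((ψ₁ (p.1 * ξ₁) : Circle) : ℂ) ∂(μ.prod (μ.prod μ)) =
    ∫ x, (∫ z, ((max 1 (max ((normAbs F x : ℝ≥0) : ℝ) ((normAbs F z : ℝ≥0) : ℝ)) : ℝ) : ℂ) ^ (-s) *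
        (∫ y, ((max 1 (max ((normAbs F y : ℝ≥0) : ℝ) ((normAbs F (z - x * y) : ℝ≥0) : ℝ)) : ℝ) : ℂ) ^ (-s) * ((ψ₂ (y * ξ₂) : Circle) : ℂ) ∂μ) ∂μ) *
        ((ψ₁ (x * ξ₁) : Circle) : ℂ) ∂μ := by
  haveI : T2Space F := (isLocalField F).toT2Space
  haveI : SecondCountableTopology F := secondCountableTopology_localField F
  haveI : LocallyCompactSpace F := (isLocalField F).toLocallyCompactSpace
  rw [integral_prod _ (integrable_twistedIntegrand μ hψ₁ hψ₂ ξ₁ ξ₂ hs)]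
  refine integral_congr_ae (Eventually.of_forall fun x => ?_)
  simp only
  rw [integral_mul_const, integral_prod _ (integrable_twisted_zySection μ hψ₂ ξ₂ hs x)]
  simp_rw [integral_const_mul]

/-- **THE UNIT VALUE, HAAR FORM** (`ψᵢ` of conductor exponent `mᵢ`, `ξᵢ ∈ 𝔭^{mᵢ} ∖ 𝔭^{mᵢ+1}`, `Re s > 1`): the integral of `g_s` over `N(F) ≅ F × (F × F)` against the product Haar
measure is `μ(𝒪)³·(1 − q^{−s})²·(1 − q^{−(2s−1)})`. [cite: CasselmanShalika1980, Thm. 5.4] [cite: Casselman1980, Thm. 3.1] -/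
theorem integral_prod_bigCell_whittaker_gl3_eq {ψ₁ ψ₂ : AddChar F Circle} (hψ₁ : Continuous ψ₁) (hψ₂ : Continuous ψ₂) {m₁ m₂ : ℤ}
    (hm₁ : ψ₁.HasConductorExp m₁) (hm₂ : ψ₂.HasConductorExp m₂) {ξ₁ ξ₂ : F}
    (hξ₁ : ξ₁ ∈ primePowBall F m₁) (hξ₁' : ξ₁ ∉ primePowBall F (m₁ + 1)) (hξ₂ : ξ₂ ∈ primePowBall F m₂) (hξ₂' : ξ₂ ∉ primePowBall F (m₂ + 1))
    {s : ℂ} (hs : 1 < s.re) :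
    ∫ p : F × (F × F), ((max 1 (max ((normAbs F p.1 : ℝ≥0) : ℝ) ((normAbs F p.2.1 : ℝ≥0) : ℝ)) : ℝ) : ℂ) ^ (-s) *
      (((max 1 (max ((normAbs F p.2.2 : ℝ≥0) : ℝ) ((normAbs F (p.2.1 - p.1 * p.2.2) : ℝ≥0) : ℝ)) : ℝ) : ℂ) ^ (-s) * ((ψ₂ (p.2.2 * ξ₂) : Circle) : ℂ)) *
        ((ψ₁ (p.1 * ξ₁) : Circle) : ℂ) ∂(μ.prod (μ.prod μ)) =
      (μ.real (primePowBall F 0) : ℂ) ^ 3 * ((1 - (residueFieldCard F : ℂ) ^ (-s)) ^ 2 * (1 - (residueFieldCard F : ℂ) ^ (-(2 * s - 1)))) := by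
  rw [integral_prod_twisted_eq_iterated μ hψ₁ hψ₂ ξ₁ ξ₂ hs, integral_bigCell_whittaker_gl3_eq μ hψ₁ hψ₂ hm₁ hm₂ hξ₁ hξ₁' hξ₂ hξ₂' hs]

/-- **THE `t`-SYMBOL ORDER** (the two-variable symbol `Ψ(x,y) = ∫_z max(1,‖x‖,‖z‖)^{−s} max(1,‖y‖,‖z−xy‖)^{−s} dμ(z)` of CONVENTIONS W0₃ §3 innermost; `ψᵢ`, `ξᵢ` as above, `Re s > 1`):
`∫_x ( ∫_y Ψ(x,y) ψ₂(yξ₂) dμ ) ψ₁(xξ₁) dμ = μ(𝒪)³·(1 − q^{−s})²·(1 − q^{−(2s−1)})` (Fubini on the `(z,y)`-block, ★ `integral_integral_swap`).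
[cite: CasselmanShalika1980, Thm. 5.4] [cite: Casselman1980, Thm. 3.1] -/
theorem integral_bigCell_whittaker_gl3_eq_symbolOrder {ψ₁ ψ₂ : AddChar F Circle} (hψ₁ : Continuous ψ₁) (hψ₂ : Continuous ψ₂) {m₁ m₂ : ℤ}
    (hm₁ : ψ₁.HasConductorExp m₁) (hm₂ : ψ₂.HasConductorExp m₂) {ξ₁ ξ₂ : F}
    (hξ₁ : ξ₁ ∈ primePowBall F m₁) (hξ₁' : ξ₁ ∉ primePowBall F (m₁ + 1)) (hξ₂ : ξ₂ ∈ primePowBall F m₂) (hξ₂' : ξ₂ ∉ primePowBall F (m₂ + 1))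
    {s : ℂ} (hs : 1 < s.re) :
    ∫ x, (∫ y, (∫ z, ((max 1 (max ((normAbs F x : ℝ≥0) : ℝ) ((normAbs F z : ℝ≥0) : ℝ)) : ℝ) : ℂ) ^ (-s) *
        ((max 1 (max ((normAbs F y : ℝ≥0) : ℝ) ((normAbs F (z - x * y) : ℝ≥0) : ℝ)) : ℝ) : ℂ) ^ (-s) ∂μ) * ((ψ₂ (y * ξ₂) : Circle) : ℂ) ∂μ) *
        ((ψ₁ (x * ξ₁) : Circle) : ℂ) ∂μ =
      (μ.real (primePowBall F 0) : ℂ) ^ 3 * ((1 - (residueFieldCard F : ℂ) ^ (-s)) ^ 2 * (1 - (residueFieldCard F : ℂ) ^ (-(2 * s - 1)))) := by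
  haveI : T2Space F := (isLocalField F).toT2Space
  haveI : SecondCountableTopology F := secondCountableTopology_localField F
  haveI : LocallyCompactSpace F := (isLocalField F).toLocallyCompactSpace
  rw [← integral_bigCell_whittaker_gl3_eq μ hψ₁ hψ₂ hm₁ hm₂ hξ₁ hξ₁' hξ₂ hξ₂' hs]
  refine integral_congr_ae (Eventually.of_forall fun x => ?_)
  have hswap := integral_integral_swap (μ := μ) (ν := μ)
    (f := fun z y => ((max 1 (max ((normAbs F x : ℝ≥0) : ℝ) ((normAbs F z : ℝ≥0) : ℝ)) : ℝ) : ℂ) ^ (-s) *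
      (((max 1 (max ((normAbs F y : ℝ≥0) : ℝ) ((normAbs F (z - x * y) : ℝ≥0) : ℝ)) : ℝ) : ℂ) ^ (-s) * ((ψ₂ (y * ξ₂) : Circle) : ℂ)))
    (integrable_twisted_zySection μ hψ₂ ξ₂ hs x)
  beta_reduce at hswap ⊢
  congr 1
  simp_rw [← integral_const_mul]
  rw [hswap]
  simp_rw [← mul_assoc, integral_mul_const]

/-- **THE TRIVIAL BOUND ON THE WINDOW, UNIFORM IN THE FREQUENCIES** (every continuous `ψ₁, ψ₂`, every `ξ₁, ξ₂`, `σ = Re s > 1`):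
`‖∫_x (∫_z∫_y … ψ₂) ψ₁ dμ³‖ ≤ μ(𝒪)³·((1−q^{−σ})∕(1−q^{1−σ}))²·(1−q^{−(2σ−1)})∕(1−q^{−(2σ−2)})` = the UNTWISTED split scalar of ★ `integral_prod_bigCell_spherical_gl3_eq` at `σ` (`|ψ| = 1`).
[cite: Casselman1980, Thm. 3.1] [cite: MoeglinWaldspurger1995, II.1.7] -/
theorem norm_integral_bigCell_whittaker_gl3_le {ψ₁ ψ₂ : AddChar F Circle} (hψ₁ : Continuous ψ₁) (hψ₂ : Continuous ψ₂) (ξ₁ ξ₂ : F) {s : ℂ} (hs : 1 < s.re) :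
    ‖∫ x, (∫ z, ((max 1 (max ((normAbs F x : ℝ≥0) : ℝ) ((normAbs F z : ℝ≥0) : ℝ)) : ℝ) : ℂ) ^ (-s) *
        (∫ y, ((max 1 (max ((normAbs F y : ℝ≥0) : ℝ) ((normAbs F (z - x * y) : ℝ≥0) : ℝ)) : ℝ) : ℂ) ^ (-s) * ((ψ₂ (y * ξ₂) : Circle) : ℂ) ∂μ) ∂μ) *
        ((ψ₁ (x * ξ₁) : Circle) : ℂ) ∂μ‖ ≤
      μ.real (primePowBall F 0) ^ 3 *
        (((1 - (residueFieldCard F : ℝ) ^ (-s.re)) / (1 - (residueFieldCard F : ℝ) ^ (1 - s.re))) ^ 2 *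
          ((1 - (residueFieldCard F : ℝ) ^ (-(2 * s.re - 1))) / (1 - (residueFieldCard F : ℝ) ^ (-(2 * s.re - 2))))) := by
  rw [← integral_prod_twisted_eq_iterated μ hψ₁ hψ₂ ξ₁ ξ₂ hs, ← integral_prod_bigCell_spherical_gl3_eq μ hs]
  refine (norm_integral_le_integral_norm _).trans (le_of_eq (integral_congr_ae (Eventually.of_forall fun p => ?_)))
  exact norm_twistedIntegrand ψ₁ ψ₂ ξ₁ ξ₂ s p

/-- **HOLOMORPHY ON THE WINDOW** (every continuous `ψ₁, ψ₂`, every `ξ₁, ξ₂`): `s ↦ ∫_x (∫_z∫_y max(1,‖x‖,‖z‖)^{−s} max(1,‖y‖,‖z−xy‖)^{−s} ψ₂(yξ₂)) ψ₁(xξ₁) dμ³` is holomorphic on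
`{1 < Re s}` — dominated holomorphy (★ `Literature.Analysis.Complex.differentiableOn_integral_of_dominated`) of the Haar form: the integrand is entire in `s`, and on the disc
`B(s₀, R)`, `R = (Re s₀ − 1)∕2`, it is majorised by the ★ untwisted integrand at `σ₀ = Re s₀ − R > 1`.  NOT claimed entire (see the file header). [cite: Casselman1980, Thm. 3.1]
[cite: CasselmanShalika1980, Thm. 5.4] -/
theorem differentiableOn_integral_bigCell_whittaker_gl3 {ψ₁ ψ₂ : AddChar F Circle} (hψ₁ : Continuous ψ₁) (hψ₂ : Continuous ψ₂) (ξ₁ ξ₂ : F) :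
    DifferentiableOn ℂ (fun s : ℂ => ∫ x, (∫ z, ((max 1 (max ((normAbs F x : ℝ≥0) : ℝ) ((normAbs F z : ℝ≥0) : ℝ)) : ℝ) : ℂ) ^ (-s) *
        (∫ y, ((max 1 (max ((normAbs F y : ℝ≥0) : ℝ) ((normAbs F (z - x * y) : ℝ≥0) : ℝ)) : ℝ) : ℂ) ^ (-s) * ((ψ₂ (y * ξ₂) : Circle) : ℂ) ∂μ) ∂μ) *
        ((ψ₁ (x * ξ₁) : Circle) : ℂ) ∂μ) {s : ℂ | 1 < s.re} := by
  haveI : T2Space F := (isLocalField F).toT2Space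
  haveI : SecondCountableTopology F := secondCountableTopology_localField F
  haveI : LocallyCompactSpace F := (isLocalField F).toLocallyCompactSpace
  -- holomorphy of the Haar form, then transfer along Fubini
  refine DifferentiableOn.congr (f := fun s : ℂ => ∫ p : F × (F × F), ((max 1 (max ((normAbs F p.1 : ℝ≥0) : ℝ) ((normAbs F p.2.1 : ℝ≥0) : ℝ)) : ℝ) : ℂ) ^ (-s) *
      (((max 1 (max ((normAbs F p.2.2 : ℝ≥0) : ℝ) ((normAbs F (p.2.1 - p.1 * p.2.2) : ℝ≥0) : ℝ)) : ℝ) : ℂ) ^ (-s) * ((ψ₂ (p.2.2 * ξ₂) : Circle) : ℂ)) *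
        ((ψ₁ (p.1 * ξ₁) : Circle) : ℂ) ∂(μ.prod (μ.prod μ))) ?_ (fun s hs => (integral_prod_twisted_eq_iterated μ hψ₁ hψ₂ ξ₁ ξ₂ hs).symm)
  refine Literature.Analysis.Complex.differentiableOn_integral_of_dominated
    (fun s _ => (continuous_twistedIntegrand hψ₁ hψ₂ ξ₁ ξ₂ s).aestronglyMeasurable) (Eventually.of_forall fun p => ?_) fun s₀ hs₀ => ?_
  · -- the integrand is entire in `s`
    have hA : ((max 1 (max ((normAbs F p.1 : ℝ≥0) : ℝ) ((normAbs F p.2.1 : ℝ≥0) : ℝ)) : ℝ) : ℂ) ≠ 0 := by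
      exact_mod_cast (one_pos.trans_le (le_max_left _ _)).ne'
    have hB : ((max 1 (max ((normAbs F p.2.2 : ℝ≥0) : ℝ) ((normAbs F (p.2.1 - p.1 * p.2.2) : ℝ≥0) : ℝ)) : ℝ) : ℂ) ≠ 0 := by
      exact_mod_cast (one_pos.trans_le (le_max_left _ _)).ne'
    exact (((differentiable_id.neg.const_cpow (Or.inl hA)).mul (((differentiable_id.neg.const_cpow (Or.inl hB)).mul_const _))).mul_const _).differentiableOn
  · -- local domination on the disc `B(s₀, R)` by the untwisted integrand at `σ₀ = Re s₀ − R`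
    have hs₀' : 1 < s₀.re := hs₀
    set R : ℝ := (s₀.re - 1) / 2 with hR
    have hR0 : 0 < R := by rw [hR]; linarith
    have hσ₀ : 1 < s₀.re - R := by rw [hR]; linarith
    have hball : ∀ s ∈ Metric.ball s₀ R, s₀.re - R ≤ s.re := fun s hs => by
      have h1 : |s.re - s₀.re| ≤ ‖s - s₀‖ := by simpa [Complex.sub_re] using Complex.abs_re_le_norm (s - s₀)
      have h2 := abs_le.mp (h1.trans (mem_ball_iff_norm.mp hs).le)
      linarith [h2.1]
    refine ⟨R, hR0, fun s hs => lt_of_lt_of_le hσ₀ (hball s hs), _, integrable_bigCellIntegrand μ hσ₀, Eventually.of_forall fun p s hs => ?_⟩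
    rw [norm_twistedIntegrand]
    exact mul_le_mul (Real.rpow_le_rpow_of_exponent_le (le_max_left _ _) (by linarith [hball s hs]))
      (Real.rpow_le_rpow_of_exponent_le (le_max_left _ _) (by linarith [hball s hs])) (Real.rpow_nonneg (zero_le_one.trans (le_max_left _ _)) _)
      (Real.rpow_nonneg (zero_le_one.trans (le_max_left _ _)) _)

end Summit.HodgeConjecture.HodgeConjecture.Cruxes.H413.K2E1FiniteWhittakerSplitU3

end
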